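import Summits.ValiantsHypothesis.ValiantsHypothesis.Theorems.LacunarySymmetroidMatrixDescartesDoorA26WallBubblingTouchLiftPhi

/-!
# `DoorA26` / line `wall_bubbling` — INTERPOLATION BY REAL EXPONENTIAL SUMS (the Chebyshev step of the φ-lift) and the φ-lift for ≤ 6 touches

HONEST FRAMING.  Object-search cell `pub-symmetroid`, crux `Theses.LacunarySymmetroid.DoorA26` (stmt-ValiantsHypothesis-19979; OPEN, typed, never
asserted).  W2 seat val-sym-door-p1 g17, file #45; def-free helper continuing #44 (`…WallBubblingTouchLiftPhi`), whose scalar perturbation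
coefficients `c` were data.  Here they are DISCHARGED when at most six abscissae need a prescribed push direction:

* `expSum_coeff_eq_zero` — distinct real exponentials are linearly independent: `Σ_l c_l e^{δ_l t} = 0` for all `t` with `δ` injective forces `c = 0`
  (induction on the number of terms: multiply by `e^{−δ₀ t}`, differentiate — tree lemma `Census.RealExp.hasDerivAt_expSum` — and the `l = 0` term drops);
* `exists_expSum_interpolate` — for injective `δ : Fin K → ℝ` and `K` distinct nodes `t_j` every value vector is attained: `∃ c, ∀ j, Σ_l c_l e^{δ_l t_j} = v_j`
  (the evaluation map is a linear endomorphism of `ℝ^K`, injective by Laguerre's count `Census.RealExp.expSum_zero_or_ncard_le` + independence, hence surjective);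
* `mem_twentyLocus_of_touches_alternations_six` — the φ-LIFT of #44 with the coefficients discharged: six designated abscissae `e : Fin 6 ↪ Fin 21` containing
  every touch; at a touch `det P = 0 ≠ tr P`; sign-only alternation data `κ` ⇒ `δ ∈ Bubbling.TwentyLocus` (choose `φ(τ_{e i}) = κ_{e i} tr P(τ_{e i})`).

READING for (R): every single-cluster limit profile with at most SIX rank-one double zeros (any mixture of inside/outside touches) and simple zeros elsewhere, in
alternating position, is a member of the twenty-locus — no data left to supply.  Nothing here bears on `DoorA26`, `DoorA34`, `MatrixDescartes` (18050) or
`VP ≠ VNP`; registers unchanged.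

[folklore] linear independence of distinct exponentials; interpolation by a Chebyshev system; [this work] the packaging.
-/

-- `Summit.ValiantsHypothesis.ValiantsHypothesis.…` repeats a component by the D-0017 layout
-- (single-conjunct summit), which the `dupNamespace` linter flags; the name is mandated.
set_option linter.dupNamespace false

namespace Summit.ValiantsHypothesis.ValiantsHypothesis.Theorems.LacunarySymmetroidMatrixDescartes.WallBubbling

open Finset Filter Topology
open Bubbling (TwentyLocus)
open Census.RealExp (hasDerivAt_expSum expSum_zero_or_ncard_le)

/-! ## §1 Linear independence of distinct real exponentials -/

/-- **Distinct real exponentials are linearly independent**: if `Σ_l c_l e^{δ_l t} = 0` for every real `t` and the exponents `δ_l` are pairwise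
distinct, then every `c_l = 0`. [folklore] -/
theorem expSum_coeff_eq_zero : ∀ (K : ℕ) (δ : Fin K → ℝ), Function.Injective δ → ∀ c : Fin K → ℝ,
    (∀ t : ℝ, ∑ l, c l * Real.exp (δ l * t) = 0) → c = 0 := by
  intro K
  induction K with
  | zero => intro δ _ c _; funext l; exact Fin.elim0 l
  | succ K ih =>
    intro δ hδ c h
    -- multiply by `e^{−δ₀ t}`: the sum with shifted exponents `δ_l − δ₀` vanishes identically
    have h1 : ∀ t : ℝ, ∑ l, c l * Real.exp ((δ l - δ 0) * t) = 0 := by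
      intro t
      have := congrArg (fun y => y * Real.exp (-(δ 0 * t))) (h t)
      simp only [zero_mul, Finset.sum_mul] at this
      rw [← this]
      refine Finset.sum_congr rfl fun l _ => ?_
      rw [mul_assoc, ← Real.exp_add]; ring_nf
    -- differentiate: the derivative sum vanishes identically as well
    have h2 : ∀ t : ℝ, ∑ l, c l * ((δ l - δ 0) * Real.exp ((δ l - δ 0) * t)) = 0 := by
      intro t
      have hd := hasDerivAt_expSum c (fun l => δ l - δ 0) t
      have hz : HasDerivAt (fun y : ℝ => ∑ l, c l * Real.exp ((δ l - δ 0) * y)) 0 t := by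
        have hf : (fun y : ℝ => ∑ l, c l * Real.exp ((δ l - δ 0) * y)) = fun _ => (0 : ℝ) := funext h1
        rw [hf]; exact hasDerivAt_const t 0
      exact hd.unique hz
    -- drop the `l = 0` term and apply the induction hypothesis to the tail
    have h3 : ∀ t : ℝ, ∑ l : Fin K, (c l.succ * (δ l.succ - δ 0)) * Real.exp ((δ l.succ - δ 0) * t) = 0 := by
      intro t
      have := h2 t
      rw [Fin.sum_univ_succ] at this
      simp only [sub_self, zero_mul, mul_zero, zero_add] at this
      rw [← this]
      refine Finset.sum_congr rfl fun l _ => ?_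
      ring
    have hinj : Function.Injective (fun l : Fin K => δ l.succ - δ 0) := by
      intro a b hab
      have : δ a.succ = δ b.succ := by simpa using hab
      exact Fin.succ_injective _ (hδ this)
    have htail := ih (fun l => δ l.succ - δ 0) hinj (fun l => c l.succ * (δ l.succ - δ 0)) h3
    have hsucc : ∀ l : Fin K, c l.succ = 0 := by
      intro l
      have hl := congrFun htail l
      simp only [Pi.zero_apply, mul_eq_zero] at hl
      rcases hl with hl | hl
      · exact hl
      · exact absurd (hδ (sub_eq_zero.mp hl)) (Fin.succ_ne_zero l)
    -- finally the head coefficient, from `t = 0`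
    have h0 : c 0 = 0 := by
      have := h 0
      rw [Fin.sum_univ_succ] at this
      simpa [hsucc] using this
    funext l
    refine Fin.cases ?_ (fun i => ?_) l
    · simpa using h0
    · simpa using hsucc i

/-! ## §2 Interpolation at `K` distinct nodes -/

/-- **Interpolation by a `K`-term exponential sum with prescribed distinct exponents at `K` distinct nodes.** [folklore] -/
theorem exists_expSum_interpolate {K : ℕ} (δ : Fin K → ℝ) (hδ : Function.Injective δ) (t : Fin K → ℝ)
    (ht : Function.Injective t) (v : Fin K → ℝ) :
    ∃ c : Fin K → ℝ, ∀ j, ∑ l, c l * Real.exp (δ l * t j) = v j := by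
  classical
  -- the evaluation map
  let L : (Fin K → ℝ) →ₗ[ℝ] (Fin K → ℝ) :=
    { toFun := fun c j => ∑ l, c l * Real.exp (δ l * t j)
      map_add' := by intro a b; funext j; simp [add_mul, Finset.sum_add_distrib]
      map_smul' := by intro r a; funext j; simp [Finset.mul_sum, mul_assoc] }
  have hinj : Function.Injective L := by
    rw [← LinearMap.ker_eq_bot, LinearMap.ker_eq_bot']
    intro c hc
    by_cases hK0 : K = 0
    · subst hK0; funext l; exact Fin.elim0 l
    have hKpos : 0 < K := Nat.pos_of_ne_zero hK0
    -- the exponential sum of `c` vanishes at the `K` distinct nodes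
    have hzero : ∀ j, ∑ l, c l * Real.exp (δ l * t j) = 0 := fun j => congrFun hc j
    rcases expSum_zero_or_ncard_le c δ with hall | ⟨hfin, hle⟩
    · exact expSum_coeff_eq_zero K δ hδ c hall
    · exfalso
      have hsub : Set.range t ⊆ {x | ∑ l, c l * Real.exp (δ l * x) = 0} := by
        rintro x ⟨j, rfl⟩; exact hzero j
      have hK : (Set.range t).ncard = K := by
        rw [Set.ncard_range_of_injective ht, Nat.card_eq_fintype_card, Fintype.card_fin]
      have h1 : K ≤ (univ.image δ).card - 1 := by
        calc K = (Set.range t).ncard := hK.symm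
          _ ≤ _ := Set.ncard_le_ncard hsub hfin
          _ ≤ _ := hle
      have h2 : (univ.image δ).card ≤ K := by
        calc (univ.image δ).card ≤ (univ : Finset (Fin K)).card := Finset.card_image_le
          _ = K := Finset.card_fin K
      omega
  have hsurj : Function.Surjective L := LinearMap.surjective_of_injective hinj
  obtain ⟨c, hc⟩ := hsurj v
  exact ⟨c, fun j => congrFun hc j⟩

/-! ## §3 The φ-lift with at most six designated abscissae -/

/-- `a ≠ 0 → 0 < a ^ 2` (helper). [folklore] -/
theorem pow_pos_of_ne_zero' {a : ℝ} (h : a ≠ 0) : 0 < a ^ 2 := by positivity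


/-- **THE φ-LIFT FOR AT MOST SIX TOUCHES (coefficients discharged).**  Strictly increasing real exponents `δ`, symmetric letters, `21` increasing log-time
abscissae `τ` with sign-only alternation data `κ`, and an injection `e : Fin 6 → Fin 21` of six DESIGNATED abscissae such that every abscissa is either a
non-touch (`0 < κ_j det P(τ_j)`) or a designated touch (`det P(τ_j) = 0 ≠ tr P(τ_j)`, `j ∈ range e`).  Then `δ ∈ TwentyLocus`. [this work] -/
theorem mem_twentyLocus_of_touches_alternations_six (δ : Fin 6 → ℝ) (hd : StrictMono δ) (S : Fin 6 → Matrix (Fin 2) (Fin 2) ℝ)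
    (hS : ∀ l, (S l).IsSymm) (τ : Fin 21 → ℝ) (hτ : StrictMono τ) (κ : Fin 21 → ℝ) (e : Fin 6 → Fin 21) (he : Function.Injective e)
    (hκ : ∀ j, 0 < κ j * (∑ l, Real.exp (δ l * τ j) • S l).det ∨
      ((∑ l, Real.exp (δ l * τ j) • S l).det = 0 ∧ (∑ l, Real.exp (δ l * τ j) • S l).trace ≠ 0 ∧ j ∈ Set.range e))
    (halt : ∀ j : Fin 20, κ j.castSucc * κ j.succ < 0) :
    δ ∈ TwentyLocus := by
  -- interpolate `φ(τ_{e i}) = κ_{e i} · tr P(τ_{e i})` at the six designated nodes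
  obtain ⟨c, hc⟩ := exists_expSum_interpolate δ hd.injective (fun i => τ (e i)) (hτ.injective.comp he)
    (fun i => κ (e i) * (∑ l, Real.exp (δ l * τ (e i)) • S l).trace)
  refine mem_twentyLocus_of_touches_alternations_phi δ S hS τ hτ κ c ?_ halt
  intro j
  rcases hκ j with h | ⟨hD, hT, ⟨i, rfl⟩⟩
  · exact Or.inl h
  · refine Or.inr ⟨hD, ?_⟩
    rw [hc i]
    have hk : κ (e i) ≠ 0 := by
      -- `κ` alternates, so no entry vanishes
      intro hz
      rcases Fin.eq_castSucc_or_eq_last (e i) with ⟨m, hm⟩ | hlast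
      · have := halt m; rw [← hm, hz, zero_mul] at this; exact lt_irrefl _ this
      · have := halt (Fin.last 19); rw [Fin.succ_last, ← hlast, hz, mul_zero] at this; exact lt_irrefl _ this
    have : κ (e i) * (κ (e i) * (∑ l, Real.exp (δ l * τ (e i)) • S l).trace) * (∑ l, Real.exp (δ l * τ (e i)) • S l).trace
        = (κ (e i) * (∑ l, Real.exp (δ l * τ (e i)) • S l).trace) ^ 2 := by ring
    rw [this]
    exact pow_pos_of_ne_zero' (mul_ne_zero hk hT)

end Summit.ValiantsHypothesis.ValiantsHypothesis.Theorems.LacunarySymmetroidMatrixDescartes.WallBubbling
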